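import Summits.Langlands.Langlands.Theorems.PhantomRMYoshidaResiduallyYoshidaLiftingSplitFrame
import Mathlib.NumberTheory.Padics.Complex
import HarnessLib

/-!
# Ribet's non-split lattice over `ℤ̄_p` — lifting `GL(K)`-valued homomorphisms to `GL(𝒪)`

Lead prover-line-stmt-Langlands-13639-c2-0 (line `sector-klingen-split`, crux `ResiduallyYoshidaLifting`,
stmt-Langlands-13639), toward the registered stub `stub_ribetNonsplitLattice` (census §7 R1(a)).
The tree's `mem_range_generalLinearGroup_map_iff` / `exists_monoidHom_map_eq` (Literature, `StableLattice` /
`ResidualRepresentation`) are stated for the index type `Fin n`; the Ribet files work with block indices `m ⊕ n`,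
so we restate both for an arbitrary finite index type over `𝒪 = 𝒪(ℚ̄_p)` (same proofs). [folklore]
-/

noncomputable section

open scoped MatrixGroups

open Matrix IsLocalRing

-- `Summit.Langlands.Langlands.…` (summit = sub-problem name, D-0017 layout) trips `dupNamespace` on every decl.
set_option linter.dupNamespace false
set_option autoImplicit false

namespace Summit.Langlands.Langlands.Cruxes.ResiduallyYoshidaLifting.SectorKlingenSplit.Ribet

open Summit.Langlands.Langlands.Cruxes.ResiduallyYoshidaLifting.EndoscopicCrossingEuler

section Lift

variable {p : ℕ} [Fact p.Prime]

/-! ### Lifting `GL(K)`-valued homomorphisms to `GL(𝒪)` (arbitrary finite index type) -/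

/-- A matrix `g ∈ GL(K)` is the image of an element of `GL(𝒪)` iff `g` and `g⁻¹` have entries in `𝒪`
(the tree's `mem_range_generalLinearGroup_map_iff`, for an arbitrary finite index type). [folklore] -/
theorem mem_range_map_subtype_iff {ι : Type*} [Fintype ι] [DecidableEq ι] {g : GL ι (PadicAlgCl p)} :
    g ∈ (Matrix.GeneralLinearGroup.map (n := ι) (Valued.integer (PadicAlgCl p)).subtype).range ↔
      (∀ i j, (g : Matrix ι ι (PadicAlgCl p)) i j ∈ Valued.integer (PadicAlgCl p)) ∧
        ∀ i j, ((g⁻¹ : GL ι (PadicAlgCl p)) : Matrix ι ι (PadicAlgCl p)) i j ∈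
          Valued.integer (PadicAlgCl p) := by
  constructor
  · rintro ⟨M, rfl⟩
    refine ⟨fun i j => ?_, fun i j => ?_⟩
    · simp [Matrix.GeneralLinearGroup.map]
    · rw [← map_inv]
      simp [Matrix.GeneralLinearGroup.map]
  · rintro ⟨h1, h2⟩
    let A : Matrix ι ι (Valued.integer (PadicAlgCl p)) := Matrix.of fun i j => ⟨_, h1 i j⟩
    let B : Matrix ι ι (Valued.integer (PadicAlgCl p)) := Matrix.of fun i j => ⟨_, h2 i j⟩
    have hA : A.map (Valued.integer (PadicAlgCl p)).subtype = (g : Matrix ι ι (PadicAlgCl p)) := by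
      ext i j; rfl
    have hB : B.map (Valued.integer (PadicAlgCl p)).subtype =
        ((g⁻¹ : GL ι (PadicAlgCl p)) : Matrix ι ι (PadicAlgCl p)) := by
      ext i j; rfl
    have hinj : Function.Injective (fun M : Matrix ι ι (Valued.integer (PadicAlgCl p)) =>
        M.map (Valued.integer (PadicAlgCl p)).subtype) := fun M N h =>
      Matrix.ext fun i j => Subtype.ext (congrFun (congrFun h i) j)
    have hAB : A * B = 1 := hinj (by
      change (A * B).map _ = (1 : Matrix ι ι _).map _
      rw [Matrix.map_mul, hA, hB, Matrix.map_one _ (map_zero _) (map_one _)]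
      exact_mod_cast g.mul_inv)
    have hBA : B * A = 1 := hinj (by
      change (B * A).map _ = (1 : Matrix ι ι _).map _
      rw [Matrix.map_mul, hA, hB, Matrix.map_one _ (map_zero _) (map_one _)]
      exact_mod_cast g.inv_mul)
    refine ⟨⟨A, B, hAB, hBA⟩, Units.ext ?_⟩
    exact hA

/-- A homomorphism `Γ → GL(K)` with values in the image of `GL(𝒪)` lifts to `Γ → GL(𝒪)` (the tree's
`exists_monoidHom_map_eq`, for an arbitrary finite index type). [folklore] -/
theorem exists_monoidHom_map_eq' {Γ : Type*} [Group Γ] {ι : Type*} [Fintype ι] [DecidableEq ι]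
    (φ : Γ →* GL ι (PadicAlgCl p))
    (hφ : ∀ g, φ g ∈ (Matrix.GeneralLinearGroup.map (n := ι) (Valued.integer (PadicAlgCl p)).subtype).range) :
    ∃ φ₀ : Γ →* GL ι (Valued.integer (PadicAlgCl p)),
      ∀ g, Matrix.GeneralLinearGroup.map (Valued.integer (PadicAlgCl p)).subtype (φ₀ g) = φ g := by
  have hinj : Function.Injective
      (Matrix.GeneralLinearGroup.map (n := ι) (Valued.integer (PadicAlgCl p)).subtype) := by
    intro A B h
    refine Units.ext (Matrix.ext fun i j => Subtype.ext ?_)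
    have := congrArg (fun M : GL ι (PadicAlgCl p) => (M : Matrix ι ι (PadicAlgCl p)) i j) h
    simpa [Matrix.GeneralLinearGroup.map] using this
  let e : GL ι (Valued.integer (PadicAlgCl p)) ≃*
      (Matrix.GeneralLinearGroup.map (n := ι) (Valued.integer (PadicAlgCl p)).subtype).range :=
    MonoidHom.ofInjective hinj
  let φ' : Γ →* (Matrix.GeneralLinearGroup.map (n := ι) (Valued.integer (PadicAlgCl p)).subtype).range :=
    φ.codRestrict _ hφ
  refine ⟨e.symm.toMonoidHom.comp φ', fun g => ?_⟩
  have h1 : (Matrix.GeneralLinearGroup.map (Valued.integer (PadicAlgCl p)).subtype (e.symm (φ' g)) :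
      GL ι (PadicAlgCl p)) =
      ((e (e.symm (φ' g)) :
        (Matrix.GeneralLinearGroup.map (n := ι) (Valued.integer (PadicAlgCl p)).subtype).range) :
        GL ι (PadicAlgCl p)) := rfl
  rw [MonoidHom.comp_apply, MulEquiv.coe_toMonoidHom, h1, MulEquiv.apply_symm_apply]
  rfl


end Lift

/-- **Registered statement `stub_ribetGLLift`** (wrapper of `exists_monoidHom_map_eq'` with explicit binders, the
form recorded on the crux item). [folklore] -/
theorem stub_ribetGLLift :
    ∀ (p : ℕ) [Fact p.Prime] (Γ : Type) [Group Γ] (ι : Type) [Fintype ι] [DecidableEq ι]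
      (φ : Γ →* GL ι (PadicAlgCl p)),
      (∀ g, φ g ∈ (Matrix.GeneralLinearGroup.map (n := ι) (Valued.integer (PadicAlgCl p)).subtype).range) →
      ∃ φ₀ : Γ →* GL ι (Valued.integer (PadicAlgCl p)),
        ∀ g, Matrix.GeneralLinearGroup.map (Valued.integer (PadicAlgCl p)).subtype (φ₀ g) = φ g := by
  intro p _ Γ _ ι _ _ φ hφ
  exact exists_monoidHom_map_eq' φ hφ

end Summit.Langlands.Langlands.Cruxes.ResiduallyYoshidaLifting.SectorKlingenSplit.Ribet

end
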